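import Literature.Analysis.FluidPDE.TwoHalfSection
import Literature.Analysis.FluidPDE.PassiveScalarForced
import Literature.Analysis.FluidPDE.WeakSolution
import HarnessLib

/-!
# Descent of the weak formulations of a `2½`-dimensional weak solution to its planar sections

Analysis/FluidPDE support file (all proved). The converse bookkeeping to
`Literature/Analysis/FluidPDE/TwoHalfWeakEuler` (Bardos–Titi–Wiedemann 2012, proof of Cor. 2,
lift `T² → T³`): if a `2½`-dimensional field `u(t) = (v(t), θ(t)) ∘ π` on `T³`
(Majda–Bertozzi 2002, §2.3.1) is a forced weak (pressure-free) Navier–Stokes solution on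
`T³ × [0, T)` in the accepted sense `Torus.IsWeakNSSolutionForcedOn` with force
`(G(t), H(t)) ∘ π` and datum `(v₀, θ₀) ∘ π`, then

* `Torus.isWeakNSSolutionForcedOn_of_twoHalf` — the planar section `v` is a forced weak
  Navier–Stokes solution on `T² × [0, T)` with force `G` and datum `v₀`: test the three-dimensional
  identity with the purely planar lifts `(φ(t), 0) ∘ π` of the planar divergence-free test fields
  `φ`; the integrand is then the planar integrand composed with `π`, so the space integrals agree
  by measure preservation of `π`;
* the companion file `Literature/Analysis/FluidPDE/TwoHalfScalarSection` derives in the same way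
  that the vertical section `θ` is a weak sourced passive scalar driven by `v`.

The lifted test fields and the pointwise identities behind both descents are recorded first
(`Torus.isSpaceTimeTest_twoHalf_left/right`, `Torus.timeDeriv_twoHalf_left/right`,
`Torus.inner_twoHalf_convect_planar/vertical`, …).

## References

* A. J. Majda, A. L. Bertozzi, *Vorticity and Incompressible Flow* (CUP 2002), §2.3.1,
  Prop. 2.7 (two-and-a-half-dimensional flows).
* C. Bardos, E. S. Titi, E. Wiedemann, C. R. Math. Acad. Sci. Paris 350 (2012), proof of Cor. 2.
* R. J. DiPerna, P.-L. Lions, Invent. Math. 98 (1989), §II.1 (weak transport equations).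
-/

open MeasureTheory Set Filter Topology Function UnitAddTorus
open scoped ENNReal NNReal InnerProductSpace ContDiff
open Literature.Analysis.FunctionSpaces.Torus

noncomputable section

namespace Literature.Analysis.FluidPDE

namespace Torus


/-! ## Lifted test fields -/

section Tests

variable {T : ℝ} {φ : ℝ → (UnitAddTorus (Fin 2)) → (EuclideanSpace ℝ (Fin 2))} {ψ : ℝ → (UnitAddTorus (Fin 2)) → ℝ}

/-- The zero planar velocity field is jointly smooth. [folklore] -/
theorem isSmoothSpaceTimeOn_zero_vec (S : Set ℝ) :
    FunctionSpaces.Torus.IsSmoothSpaceTimeOn S (fun _ : ℝ => (0 : (UnitAddTorus (Fin 2)) → (EuclideanSpace ℝ (Fin 2)))) :=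
  isSmoothSpaceTimeOn_const (isSmooth_const (d := Fin 2) (0 : (EuclideanSpace ℝ (Fin 2)))) S

/-- The zero planar scalar is jointly smooth. [folklore] -/
theorem isSmoothSpaceTimeOn_zero_scalar (S : Set ℝ) :
    FunctionSpaces.Torus.IsSmoothSpaceTimeOn S (fun _ : ℝ => (0 : (UnitAddTorus (Fin 2)) → ℝ)) :=
  isSmoothSpaceTimeOn_const (isSmooth_const (d := Fin 2) (0 : ℝ)) S

/-- The zero planar velocity field is divergence free. [folklore] -/
theorem isDivFree_zero_vec₂ : IsDivFree (0 : (UnitAddTorus (Fin 2)) → (EuclideanSpace ℝ (Fin 2))) := by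
  intro y
  rw [divergence]
  refine Finset.sum_eq_zero fun i _ => ?_
  simp [FunctionSpaces.Torus.partialDeriv, FunctionSpaces.Torus.lineDeriv]

/-- **The purely planar lift `(φ(t), 0) ∘ π` of a planar space–time test field is a space–time
test field on `T³ × [0, T)`.** [folklore] -/
theorem isSpaceTimeTest_twoHalf_left (hφ : IsSpaceTimeTest T φ) :
    IsSpaceTimeTest T (fun t => twoHalf (φ t) 0) := by
  obtain ⟨hs, T', hT', h0⟩ := hφ
  refine ⟨?_, T', hT', fun t ht => ?_⟩
  · have h : FunctionSpaces.Torus.IsSmoothSpaceTimeOn univ (fun t => twoHalf (φ t) ((fun _ : ℝ => (0 : (UnitAddTorus (Fin 2)) → ℝ)) t)) :=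
      (isSmoothSpaceTimeOn_of_contDiff hs univ).twoHalf (isSmoothSpaceTimeOn_zero_scalar univ)
    have h' : ContDiffOn ℝ ∞ (stLift fun t => twoHalf (φ t) 0) (univ ×ˢ univ) := h
    rwa [univ_prod_univ, contDiffOn_univ] at h'
  · show twoHalf (φ t) 0 = 0
    rw [h0 t ht, twoHalf_zero]

/-- **The purely vertical lift `(0, ψ(t)) ∘ π` of a scalar space–time test function is a
space–time test field on `T³ × [0, T)`.** [folklore] -/
theorem isSpaceTimeTest_twoHalf_right (hψ : IsSpaceTimeTest T ψ) :
    IsSpaceTimeTest T (fun t => twoHalf 0 (ψ t)) := by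
  obtain ⟨hs, T', hT', h0⟩ := hψ
  refine ⟨?_, T', hT', fun t ht => ?_⟩
  · have h : FunctionSpaces.Torus.IsSmoothSpaceTimeOn univ (fun t => twoHalf ((fun _ : ℝ => (0 : (UnitAddTorus (Fin 2)) → (EuclideanSpace ℝ (Fin 2)))) t) (ψ t)) :=
      (isSmoothSpaceTimeOn_zero_vec univ).twoHalf (isSmoothSpaceTimeOn_of_contDiff hs univ)
    have h' : ContDiffOn ℝ ∞ (stLift fun t => twoHalf 0 (ψ t)) (univ ×ˢ univ) := h
    rwa [univ_prod_univ, contDiffOn_univ] at h'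
  · show twoHalf 0 (ψ t) = 0
    rw [h0 t ht, twoHalf_zero]

/-- The purely planar lift of a divergence-free planar test field is divergence free. [folklore] -/
theorem isDivFreeTest_twoHalf_left (hdiv : IsDivFreeTest φ) : IsDivFreeTest (fun t => twoHalf (φ t) 0) :=
  fun t => (hdiv t).twoHalf 0

/-- The purely vertical lift of any scalar test function is divergence free. [folklore] -/
theorem isDivFreeTest_twoHalf_right (ψ : ℝ → (UnitAddTorus (Fin 2)) → ℝ) : IsDivFreeTest (fun t => twoHalf 0 (ψ t)) :=
  fun t => isDivFree_zero_vec₂.twoHalf (ψ t)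

/-- The embedding `a ↦ (a₀, a₁, 0)` as a continuous linear map. [folklore] -/
theorem planarEmbed_comp_inl_apply (a : (EuclideanSpace ℝ (Fin 2))) :
    (planarEmbed.comp (ContinuousLinearMap.inl ℝ (EuclideanSpace ℝ (Fin 2)) ℝ)) a = planarEmbed (a, 0) := rfl

/-- The embedding `r ↦ (0, 0, r)` as a continuous linear map. [folklore] -/
theorem planarEmbed_comp_inr_apply (r : ℝ) :
    (planarEmbed.comp (ContinuousLinearMap.inr ℝ (EuclideanSpace ℝ (Fin 2)) ℝ)) r = planarEmbed (0, r) := rfl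

/-- **Time derivative of the purely planar lift**: `∂ₜ((φ, 0) ∘ π) = (∂ₜφ, 0) ∘ π`. [folklore] -/
theorem timeDeriv_twoHalf_left (hφ : IsSpaceTimeTest T φ) (t : ℝ) :
    FunctionSpaces.Torus.timeDeriv (fun s => twoHalf (φ s) 0) t = twoHalf (FunctionSpaces.Torus.timeDeriv φ t) 0 := by
  funext x
  have hd := hasDerivAt_slice_timeDeriv hφ.1 t (planarProj x)
  have h := ((planarEmbed.comp (ContinuousLinearMap.inl ℝ (EuclideanSpace ℝ (Fin 2)) ℝ)).hasFDerivAt.comp_hasDerivAt t hd).deriv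
  simp only [Function.comp_def, planarEmbed_comp_inl_apply] at h
  exact h

/-- **Time derivative of the purely vertical lift**: `∂ₜ((0, ψ) ∘ π) = (0, ∂ₜψ) ∘ π`. [folklore] -/
theorem timeDeriv_twoHalf_right (hψ : IsSpaceTimeTest T ψ) (t : ℝ) :
    FunctionSpaces.Torus.timeDeriv (fun s => twoHalf 0 (ψ s)) t = twoHalf 0 (FunctionSpaces.Torus.timeDeriv ψ t) := by
  funext x
  have hd := hasDerivAt_slice_timeDeriv hψ.1 t (planarProj x)
  have h := ((planarEmbed.comp (ContinuousLinearMap.inr ℝ (EuclideanSpace ℝ (Fin 2)) ℝ)).hasFDerivAt.comp_hasDerivAt t hd).deriv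
  simp only [Function.comp_def, planarEmbed_comp_inr_apply] at h
  exact h

end Tests

/-! ## Pointwise identities for the integrands -/

section Pointwise

variable (V : (UnitAddTorus (Fin 2)) → (EuclideanSpace ℝ (Fin 2))) (R : (UnitAddTorus (Fin 2)) → ℝ) {A : (UnitAddTorus (Fin 2)) → (EuclideanSpace ℝ (Fin 2))} {B : (UnitAddTorus (Fin 2)) → ℝ}

/-- The torus derivative of the zero scalar vanishes. [folklore] -/
theorem fderiv_zero_scalar₂ (y : (UnitAddTorus (Fin 2))) : FunctionSpaces.Torus.fderiv (0 : (UnitAddTorus (Fin 2)) → ℝ) y = 0 := by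
  have h : liftAt (0 : (UnitAddTorus (Fin 2)) → ℝ) y = fun _ => 0 := rfl
  simp only [FunctionSpaces.Torus.fderiv, h]
  exact fderiv_const_apply 0

/-- The torus derivative of the zero planar field vanishes. [folklore] -/
theorem fderiv_zero_vec₂ (y : (UnitAddTorus (Fin 2))) : FunctionSpaces.Torus.fderiv (0 : (UnitAddTorus (Fin 2)) → (EuclideanSpace ℝ (Fin 2))) y = 0 := by
  have h : liftAt (0 : (UnitAddTorus (Fin 2)) → (EuclideanSpace ℝ (Fin 2))) y = fun _ => 0 := rfl
  simp only [FunctionSpaces.Torus.fderiv, h]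
  exact fderiv_const_apply 0

/-- The Laplacian of the zero scalar vanishes. [folklore] -/
theorem laplacian_zero_scalar₂ (y : (UnitAddTorus (Fin 2))) : FunctionSpaces.Torus.laplacian (0 : (UnitAddTorus (Fin 2)) → ℝ) y = 0 := by
  have h : liftAt (0 : (UnitAddTorus (Fin 2)) → ℝ) y = fun _ => 0 := rfl
  simp only [FunctionSpaces.Torus.laplacian, h]
  rw [InnerProductSpace.laplacian_const]
  rfl

/-- The Laplacian of the zero planar field vanishes. [folklore] -/
theorem laplacian_zero_vec₂ (y : (UnitAddTorus (Fin 2))) : FunctionSpaces.Torus.laplacian (0 : (UnitAddTorus (Fin 2)) → (EuclideanSpace ℝ (Fin 2))) y = 0 := by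
  have h : liftAt (0 : (UnitAddTorus (Fin 2)) → (EuclideanSpace ℝ (Fin 2))) y = fun _ => 0 := rfl
  simp only [FunctionSpaces.Torus.laplacian, h]
  rw [InnerProductSpace.laplacian_const]
  rfl

/-- `⟪(V,R)∘π, (A,0)∘π⟫ = ⟪V, A⟫ ∘ π`. [folklore] -/
theorem inner_twoHalf_planar (A : (UnitAddTorus (Fin 2)) → (EuclideanSpace ℝ (Fin 2))) (x : (UnitAddTorus (Fin 3))) :
    ⟪twoHalf V R x, twoHalf A 0 x⟫_ℝ = ⟪V (planarProj x), A (planarProj x)⟫_ℝ := by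
  rw [inner_twoHalf]
  simp

/-- `⟪(V,R)∘π, (0,B)∘π⟫ = (R B) ∘ π`. [folklore] -/
theorem inner_twoHalf_vertical (B : (UnitAddTorus (Fin 2)) → ℝ) (x : (UnitAddTorus (Fin 3))) :
    ⟪twoHalf V R x, twoHalf 0 B x⟫_ℝ = R (planarProj x) * B (planarProj x) := by
  rw [inner_twoHalf]
  simp

/-- **The convective pairing against a purely planar field**:
`⟪(V,R)∘π, ((V,R)∘π · ∇)((A,0)∘π)⟫ = ⟪V, (V·∇)A⟫ ∘ π` for `C¹` `A`. [folklore] -/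
theorem inner_twoHalf_convect_planar (hA : IsContDiff 1 A) (x : (UnitAddTorus (Fin 3))) :
    ⟪twoHalf V R x, FunctionSpaces.Torus.convect (twoHalf V R) (twoHalf A 0) x⟫_ℝ =
      ⟪V (planarProj x), FunctionSpaces.Torus.convect V A (planarProj x)⟫_ℝ := by
  have h0 : IsContDiff 1 (0 : (UnitAddTorus (Fin 2)) → ℝ) := (isSmooth_const (d := Fin 2) (0 : ℝ)).isContDiff (by simp)
  rw [inner_twoHalf_convect V R hA h0, fderiv_zero_scalar₂]
  simp

/-- **The convective pairing against a purely vertical field**: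
`⟪(V,R)∘π, ((V,R)∘π · ∇)((0,B)∘π)⟫ = (R ⟪V, ∇B⟫) ∘ π` for `C¹` `B`. [folklore] -/
theorem inner_twoHalf_convect_vertical (hB : IsContDiff 1 B) (x : (UnitAddTorus (Fin 3))) :
    ⟪twoHalf V R x, FunctionSpaces.Torus.convect (twoHalf V R) (twoHalf 0 B) x⟫_ℝ =
      R (planarProj x) * ⟪V (planarProj x), FunctionSpaces.Torus.gradient B (planarProj x)⟫_ℝ := by
  have h0 : IsContDiff 1 (0 : (UnitAddTorus (Fin 2)) → (EuclideanSpace ℝ (Fin 2))) := (isSmooth_const (d := Fin 2) (0 : (EuclideanSpace ℝ (Fin 2)))).isContDiff (by simp)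
  have h1 : FunctionSpaces.Torus.convect V (0 : (UnitAddTorus (Fin 2)) → (EuclideanSpace ℝ (Fin 2))) (planarProj x) = 0 := by
    rw [FunctionSpaces.Torus.convect, fderiv_zero_vec₂, zero_apply]
  rw [inner_twoHalf_convect V R h0 hB, h1, inner_zero_right, zero_add, ← FunctionSpaces.Torus.inner_gradient_left,
    real_inner_comm]

/-- **The viscous pairing against a purely planar field**:
`⟪(V,R)∘π, Δ((A,0)∘π)⟫ = ⟪V, ΔA⟫ ∘ π` for smooth `A`. [folklore] -/
theorem inner_twoHalf_laplacian_planar (hA : IsSmooth A) (x : (UnitAddTorus (Fin 3))) :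
    ⟪twoHalf V R x, FunctionSpaces.Torus.laplacian (twoHalf A 0) x⟫_ℝ =
      ⟪V (planarProj x), FunctionSpaces.Torus.laplacian A (planarProj x)⟫_ℝ := by
  have hz : IsSmooth (0 : (UnitAddTorus (Fin 2)) → ℝ) := isSmooth_const (d := Fin 2) (0 : ℝ)
  rw [laplacian_twoHalf hA hz, inner_twoHalf]
  simp [laplacian_zero_scalar₂]

/-- **The viscous pairing against a purely vertical field**:
`⟪(V,R)∘π, Δ((0,B)∘π)⟫ = (R ΔB) ∘ π` for smooth `B`. [folklore] -/
theorem inner_twoHalf_laplacian_vertical (hB : IsSmooth B) (x : (UnitAddTorus (Fin 3))) :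
    ⟪twoHalf V R x, FunctionSpaces.Torus.laplacian (twoHalf 0 B) x⟫_ℝ =
      R (planarProj x) * FunctionSpaces.Torus.laplacian B (planarProj x) := by
  have hz : IsSmooth (0 : (UnitAddTorus (Fin 2)) → (EuclideanSpace ℝ (Fin 2))) := isSmooth_const (d := Fin 2) (0 : (EuclideanSpace ℝ (Fin 2)))
  rw [laplacian_twoHalf hz hB, inner_twoHalf]
  simp [laplacian_zero_vec₂]

end Pointwise

/-! ## The planar section is a forced weak Navier–Stokes solution on `T²` -/

section PlanarWeak

variable {T ν : ℝ} {G : ℝ → (UnitAddTorus (Fin 2)) → (EuclideanSpace ℝ (Fin 2))} {H : ℝ → (UnitAddTorus (Fin 2)) → ℝ} {v₀ : (UnitAddTorus (Fin 2)) → (EuclideanSpace ℝ (Fin 2))} {θ₀ : (UnitAddTorus (Fin 2)) → ℝ}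
  {v : ℝ → (UnitAddTorus (Fin 2)) → (EuclideanSpace ℝ (Fin 2))} {θ : ℝ → (UnitAddTorus (Fin 2)) → ℝ}

/-- The planar weak Navier–Stokes integrand of the section is integrable at every slice in `L²`
with integrable force slice. [folklore] -/
theorem integrable_planarIntegrand {φ : ℝ → (UnitAddTorus (Fin 2)) → (EuclideanSpace ℝ (Fin 2))} (hφ : IsSpaceTimeTest T φ) {t : ℝ}
    (hv : MemLp (v t) 2 volume) (hG : Integrable (G t) volume) :
    Integrable (fun y => ⟪v t y, FunctionSpaces.Torus.timeDeriv φ t y⟫_ℝ +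
      ⟪v t y, FunctionSpaces.Torus.convect (v t) (φ t) y⟫_ℝ +
      ν * ⟪v t y, FunctionSpaces.Torus.laplacian (φ t) y⟫_ℝ + ⟪G t y, φ t y⟫_ℝ) volume := by
  have hs : IsSmooth (φ t) := hφ.isSmooth_slice t
  refine ((integrable_inner_timeDeriv_slice hφ hv).add (integrable_inner_convect_slice hφ hv)).add
    ((integrable_inner_of_continuous (hv.integrable one_le_two) hs.laplacian.continuous).const_mul ν)
    |>.add (integrable_inner_of_continuous hG hs.continuous)

/-- **The planar section of a `2½`-dimensional forced weak Navier–Stokes solution is a forced weak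
Navier–Stokes solution on `T²`.** If `(v(t), θ(t)) ∘ π` is a forced weak solution on
`T³ × [0, T)` with force `(G(t), H(t)) ∘ π` and datum `(v₀, θ₀) ∘ π`, the slices `v(t)`,
`t ∈ (0, T)`, and `v₀` lie in `L²(T²)` and the force slices `G(t)` are integrable, then `v` is a
forced weak solution on `T² × [0, T)` with force `G` and datum `v₀` (test the three-dimensional
identity with `(φ(t), 0) ∘ π`; Majda–Bertozzi 2002, §2.3.1; Bardos–Titi–Wiedemann 2012, proof of
Cor. 2, read backwards). [folklore] -/
theorem isWeakNSSolutionForcedOn_of_twoHalf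
    (hu : IsWeakNSSolutionForcedOn T ν (fun t => twoHalf (G t) (H t)) (twoHalf v₀ θ₀) (fun t => twoHalf (v t) (θ t)))
    (hv : ∀ t ∈ Ioo 0 T, MemLp (v t) 2 volume) (hv₀ : MemLp v₀ 2 volume)
    (hG : ∀ t ∈ Ioo 0 T, Integrable (G t) volume) :
    IsWeakNSSolutionForcedOn T ν G v₀ v := by
  obtain ⟨hm, hL2, hdiv, hweak⟩ := hu
  refine ⟨(aestronglyMeasurable_stLift_of_twoHalf hm).1, ?_, ?_, fun φ hφ hφdiv => ?_⟩
  · exact lt_of_le_of_lt (lintegral_mono fun t => lintegral_enorm_sq_left_le_twoHalf (v t) (θ t)) hL2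
  · filter_upwards [hdiv, ae_restrict_mem measurableSet_Ioo] with t ht htI
    exact isWeaklyDivFree_of_twoHalf (hv t htI) ht
  · have hid := hweak (fun t => twoHalf (φ t) 0) (isSpaceTimeTest_twoHalf_left hφ) (isDivFreeTest_twoHalf_left hφdiv)
    have hslice : ∀ t ∈ Ioo 0 T,
        (∫ x, (⟪twoHalf (v t) (θ t) x, FunctionSpaces.Torus.timeDeriv (fun s => twoHalf (φ s) 0) t x⟫_ℝ +
          ⟪twoHalf (v t) (θ t) x, FunctionSpaces.Torus.convect (twoHalf (v t) (θ t)) (twoHalf (φ t) 0) x⟫_ℝ +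
          ν * ⟪twoHalf (v t) (θ t) x, FunctionSpaces.Torus.laplacian (twoHalf (φ t) 0) x⟫_ℝ +
          ⟪twoHalf (G t) (H t) x, twoHalf (φ t) 0 x⟫_ℝ)) =
        ∫ y, (⟪v t y, FunctionSpaces.Torus.timeDeriv φ t y⟫_ℝ + ⟪v t y, FunctionSpaces.Torus.convect (v t) (φ t) y⟫_ℝ +
          ν * ⟪v t y, FunctionSpaces.Torus.laplacian (φ t) y⟫_ℝ + ⟪G t y, φ t y⟫_ℝ) := by
      intro t ht
      have hs : IsSmooth (φ t) := hφ.isSmooth_slice t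
      have hpt : ∀ x : (UnitAddTorus (Fin 3)),
          ⟪twoHalf (v t) (θ t) x, FunctionSpaces.Torus.timeDeriv (fun s => twoHalf (φ s) 0) t x⟫_ℝ +
            ⟪twoHalf (v t) (θ t) x, FunctionSpaces.Torus.convect (twoHalf (v t) (θ t)) (twoHalf (φ t) 0) x⟫_ℝ +
            ν * ⟪twoHalf (v t) (θ t) x, FunctionSpaces.Torus.laplacian (twoHalf (φ t) 0) x⟫_ℝ +
            ⟪twoHalf (G t) (H t) x, twoHalf (φ t) 0 x⟫_ℝ =
          (fun y => ⟪v t y, FunctionSpaces.Torus.timeDeriv φ t y⟫_ℝ + ⟪v t y, FunctionSpaces.Torus.convect (v t) (φ t) y⟫_ℝ +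
            ν * ⟪v t y, FunctionSpaces.Torus.laplacian (φ t) y⟫_ℝ + ⟪G t y, φ t y⟫_ℝ) (planarProj x) := by
        intro x
        rw [timeDeriv_twoHalf_left hφ, inner_twoHalf_planar, inner_twoHalf_convect_planar _ _ (hs.isContDiff (by simp)),
          inner_twoHalf_laplacian_planar _ _ hs, inner_twoHalf_planar]
      simp_rw [hpt]
      exact integral_comp_planarProj (integrable_planarIntegrand hφ (hv t ht) (hG t ht)).aestronglyMeasurable
    have hdatum : ∫ x, ⟪twoHalf v₀ θ₀ x, twoHalf (φ 0) 0 x⟫_ℝ = ∫ y, ⟪v₀ y, φ 0 y⟫_ℝ := by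
      simp_rw [inner_twoHalf_planar]
      exact integral_comp_planarProj (integrable_inner_of_memLp_two hv₀ ((hφ.isSmooth_slice 0).memLp 2)).aestronglyMeasurable
    rw [setIntegral_congr_fun measurableSet_Ioo hslice, hdatum] at hid
    exact hid

end PlanarWeak

end Torus

end Literature.Analysis.FluidPDE

end
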